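import Summits.AtomisticToContinuum.Crystallization.Theorems.ChartedZeroExcessLayeredLatticeLiouvilleYJA

/-!
# Charted zero-excess layered-lattice Liouville — YJ-B «NearFarShellSplit»: the one-bond estimate, the near/far split and the far-field bound (lens-2 g66)

Part 2 of 4 of node g66 (docket `stmt-AtomisticToContinuum-26636`), ALL PROVED, imports part YJ-A (hence the tree only; it can land at any time after YJ-A):

* **YJ-2 the ONE-BOND SECOND-DIFFERENCE ESTIMATE.**  With `s = ‖c + τ•d‖²` the Lennard-Jones bond energy is `ljSq s = s⁻⁶/12 − s⁻³/6`; two explicit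
  derivatives in `τ` (`hasDerivAt_bondPath`, `hasDerivAt_dbondPath`), the Cauchy–Schwarz chain factor `(d/dτ s)² ≤ 4s‖d‖²` and `s ≥ r₀² ≥ 1` give
  `|d²/dτ² V(‖c + τd‖)| ≤ 24‖d‖²/r₀⁸` (`abs_d2bondPath_le`), and three mean-value slopes give, for a bond that stays `≥ r₀ ≥ 1` long on the segment,
  `|Δ² V(‖c + ·d‖)(t)| ≤ 12·t²·‖d‖²/r₀⁸` for `t ∈ (0,1]` (`abs_secondDiff_lennardJones_bond_le`) — no hypothesis on `‖c‖`, `‖d‖` themselves.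
* **YJ-3 the NEAR/FAR SHELL SPLIT and the FAR-FIELD BOUND.**  `clampedEnergy X = nearClampedEnergy X x₀ R + farClampedEnergy X x₀ R` (pair sums against the
  frozen field inside / outside `B̄(x₀, R)`; `clampedEnergy_eq_near_add_far`, for summable pair sums); second differences pass through finite sums and summable
  families (`secondDiff_finset_sum`, `secondDiff_tsum`); and THE FAR-FIELD SECOND-DIFFERENCE BOUND (`abs_secondDiff_farClampedEnergy_le`): if both families lie in
  `B̄(x₀, Rc)`, `R ≥ Rc + 1`, the frozen field `X ⊆ S` has summable pair sums and the far shell's inverse-eighth moment `Σ'_{p ∈ X ∖ B̄(x₀,R)} (dist(p,x₀) − Rc)⁻⁸`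
  is `≤ T`, then `|Δ²(far ∘ segConf y xf)(t)| ≤ 12·T·t²·Σᵢ dist(xf i, y i)²`.  This is the GENERIC side of the node's dichotomy: the infinitely many far frozen
  atoms contribute a second-difference DRIFT controlled by one lattice-sum moment, whatever the configuration.
-/

noncomputable section

open scoped BigOperators Classical
open Set Metric Filter Topology
open Summit.AtomisticToContinuum.Crystallization.Theorems.ChartedPlanarOrderRigidityDoor (E3)
open Literature.MathematicalPhysics.StatisticalMechanics (lennardJones interactionEnergy)

namespace Summit.AtomisticToContinuum.Crystallization.Theorems.ChartedZeroExcessLayeredLatticeLiouville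

/-! ### The one-bond second-difference estimate for the Lennard-Jones potential (1D calculus, PROVED) -/

/-- the Lennard-Jones potential as a function of the SQUARED distance: `ljSq s = (1/12)·s⁻⁶ − (1/6)·s⁻³`. -/
def ljSq (s : ℝ) : ℝ := 1 / 12 * s⁻¹ ^ 6 - 1 / 6 * s⁻¹ ^ 3

/-- its first derivative. -/
def dljSq (s : ℝ) : ℝ := -(1 / 2) * s⁻¹ ^ 7 + 1 / 2 * s⁻¹ ^ 4

/-- its second derivative. -/
def d2ljSq (s : ℝ) : ℝ := 7 / 2 * s⁻¹ ^ 8 - 2 * s⁻¹ ^ 5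

/-- `lennardJones_eq_ljSq_sq` (docstring added by the landing lane; see the module docstring). [formal bookkeeping] -/
theorem lennardJones_eq_ljSq_sq (r : ℝ) : lennardJones r = ljSq (r ^ 2) := by
  unfold lennardJones ljSq
  simp only [inv_pow, ← pow_mul]

/-- `hasDerivAt_ljSq` (docstring added by the landing lane; see the module docstring). [formal bookkeeping] -/
theorem hasDerivAt_ljSq {s : ℝ} (hs : s ≠ 0) : HasDerivAt ljSq (dljSq s) s := by
  have hu := hasDerivAt_inv hs
  have h := ((hu.pow 6).const_mul (1 / 12)).sub ((hu.pow 3).const_mul (1 / 6))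
  refine h.congr_deriv ?_
  unfold dljSq
  rw [inv_pow]
  ring

/-- `hasDerivAt_dljSq` (docstring added by the landing lane; see the module docstring). [formal bookkeeping] -/
theorem hasDerivAt_dljSq {s : ℝ} (hs : s ≠ 0) : HasDerivAt dljSq (d2ljSq s) s := by
  have hu := hasDerivAt_inv hs
  have h := ((hu.pow 7).const_mul (-(1 / 2))).add ((hu.pow 4).const_mul (1 / 2))
  refine h.congr_deriv ?_
  unfold d2ljSq
  rw [inv_pow]
  ring

/-- the squared bond length along an affine bond path `τ ↦ c + τ·d` is the quadratic `‖c‖² + 2⟪c,d⟫τ + ‖d‖²τ²`. -/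
def sqPath (c d : E3) (τ : ℝ) : ℝ := ‖c‖ ^ 2 + 2 * inner ℝ c d * τ + ‖d‖ ^ 2 * τ ^ 2

/-- derivative of the quadratic. -/
def dsqPath (c d : E3) (τ : ℝ) : ℝ := 2 * inner ℝ c d + 2 * ‖d‖ ^ 2 * τ

/-- `norm_add_smul_sq` (docstring added by the landing lane; see the module docstring). [formal bookkeeping] -/
theorem norm_add_smul_sq (c d : E3) (τ : ℝ) : ‖c + τ • d‖ ^ 2 = sqPath c d τ := by
  unfold sqPath
  rw [norm_add_sq_real, real_inner_smul_right, norm_smul, Real.norm_eq_abs, mul_pow, sq_abs]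
  ring

/-- `hasDerivAt_sqPath` (docstring added by the landing lane; see the module docstring). [formal bookkeeping] -/
theorem hasDerivAt_sqPath (c d : E3) (τ : ℝ) : HasDerivAt (sqPath c d) (dsqPath c d τ) τ := by
  have h := ((((hasDerivAt_id τ).const_mul (2 * inner ℝ c d)).const_add (‖c‖ ^ 2)).add
    ((hasDerivAt_pow 2 τ).const_mul (‖d‖ ^ 2)))
  have h' : HasDerivAt (sqPath c d) (2 * inner ℝ c d * 1 + ‖d‖ ^ 2 * (↑2 * τ ^ (2 - 1))) τ :=
    h.congr_of_eventuallyEq (Eventually.of_forall fun x => by simp [sqPath])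
  refine h'.congr_deriv ?_
  unfold dsqPath
  norm_num
  ring

/-- `hasDerivAt_dsqPath` (docstring added by the landing lane; see the module docstring). [formal bookkeeping] -/
theorem hasDerivAt_dsqPath (c d : E3) (τ : ℝ) : HasDerivAt (dsqPath c d) (2 * ‖d‖ ^ 2) τ := by
  have h := ((hasDerivAt_id τ).const_mul (2 * ‖d‖ ^ 2)).const_add (2 * inner ℝ c d)
  have h' : HasDerivAt (dsqPath c d) (2 * ‖d‖ ^ 2 * 1) τ :=
    h.congr_of_eventuallyEq (Eventually.of_forall fun x => by simp [dsqPath])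
  refine h'.congr_deriv ?_
  ring

/-- the one-bond energy along the path, its first and second derivatives (as explicit functions). -/
def bondPath (c d : E3) (τ : ℝ) : ℝ := ljSq (sqPath c d τ)
/-- first derivative of `bondPath`. -/
def dbondPath (c d : E3) (τ : ℝ) : ℝ := dljSq (sqPath c d τ) * dsqPath c d τ
/-- second derivative of `bondPath`. -/
def d2bondPath (c d : E3) (τ : ℝ) : ℝ :=
  d2ljSq (sqPath c d τ) * dsqPath c d τ * dsqPath c d τ + dljSq (sqPath c d τ) * (2 * ‖d‖ ^ 2)

/-- `lennardJones_norm_add_smul` (docstring added by the landing lane; see the module docstring). [formal bookkeeping] -/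
theorem lennardJones_norm_add_smul (c d : E3) (τ : ℝ) : lennardJones ‖c + τ • d‖ = bondPath c d τ := by
  rw [lennardJones_eq_ljSq_sq, norm_add_smul_sq]; rfl

/-- `hasDerivAt_bondPath` (docstring added by the landing lane; see the module docstring). [formal bookkeeping] -/
theorem hasDerivAt_bondPath (c d : E3) {τ : ℝ} (hs : sqPath c d τ ≠ 0) :
    HasDerivAt (bondPath c d) (dbondPath c d τ) τ :=
  (hasDerivAt_ljSq hs).comp τ (hasDerivAt_sqPath c d τ)

/-- `hasDerivAt_dbondPath` (docstring added by the landing lane; see the module docstring). [formal bookkeeping] -/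
theorem hasDerivAt_dbondPath (c d : E3) {τ : ℝ} (hs : sqPath c d τ ≠ 0) :
    HasDerivAt (dbondPath c d) (d2bondPath c d τ) τ :=
  ((hasDerivAt_dljSq hs).comp τ (hasDerivAt_sqPath c d τ)).mul (hasDerivAt_dsqPath c d τ)

/-- the explicit second-derivative bound on the admissible range: `|bondPath″| ≤ 90·‖d‖²/r₀⁸` when the bond stays `≥ r₀ ≥ 1` long and
`‖c‖ + ‖d‖ ≤ 2 r₀`. -/
theorem abs_d2bondPath_le (c d : E3) {r₀ τ : ℝ} (hr : 1 ≤ r₀) (hseg : r₀ ≤ ‖c + τ • d‖) :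
    |d2bondPath c d τ| ≤ 24 * ‖d‖ ^ 2 / r₀ ^ 8 := by
  have hr0 : 0 < r₀ := by linarith
  have hs : r₀ ^ 2 ≤ sqPath c d τ := by
    rw [← norm_add_smul_sq]; exact pow_le_pow_left₀ hr0.le hseg 2
  have hs1 : 1 ≤ sqPath c d τ := le_trans (by nlinarith) hs
  have hspos : 0 < sqPath c d τ := by linarith
  set u : ℝ := (sqPath c d τ)⁻¹ with hu
  have hu0 : 0 < u := inv_pos.2 hspos
  have hu1 : u ≤ 1 := inv_le_one_of_one_le₀ hs1
  have hur : u ≤ (r₀ ^ 2)⁻¹ := by rw [hu]; exact inv_anti₀ (by positivity) hs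
  -- elementary bounds on the potential's derivatives
  have h1 : |dljSq (sqPath c d τ)| ≤ u ^ 4 := by
    unfold dljSq
    have h74 : u ^ 7 ≤ u ^ 4 := pow_le_pow_of_le_one hu0.le hu1 (by norm_num)
    rw [abs_le]; constructor <;> nlinarith [pow_nonneg hu0.le 7, pow_nonneg hu0.le 4]
  have h2 : |d2ljSq (sqPath c d τ)| ≤ 11 / 2 * u ^ 5 := by
    unfold d2ljSq
    have h85 : u ^ 8 ≤ u ^ 5 := pow_le_pow_of_le_one hu0.le hu1 (by norm_num)
    rw [abs_le]; constructor <;> nlinarith [pow_nonneg hu0.le 8, pow_nonneg hu0.le 5]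
  -- the chain factor: `(d/dτ ‖c+τd‖²)² = 4⟪c+τd, d⟫² ≤ 4‖c+τd‖²‖d‖²` (Cauchy–Schwarz; no hypothesis on `‖c‖`, `‖d‖`)
  have h3 : dsqPath c d τ * dsqPath c d τ ≤ 4 * sqPath c d τ * ‖d‖ ^ 2 := by
    have e : dsqPath c d τ = 2 * inner ℝ (c + τ • d) d := by
      unfold dsqPath; rw [inner_add_left, real_inner_smul_left, real_inner_self_eq_norm_sq]; ring
    have hin : |inner ℝ (c + τ • d) d| ≤ ‖c + τ • d‖ * ‖d‖ := abs_real_inner_le_norm _ _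
    have hsq : (inner ℝ (c + τ • d) d) ^ 2 ≤ (‖c + τ • d‖ * ‖d‖) ^ 2 := by
      calc (inner ℝ (c + τ • d) d) ^ 2 = |inner ℝ (c + τ • d) d| ^ 2 := (sq_abs _).symm
        _ ≤ (‖c + τ • d‖ * ‖d‖) ^ 2 := pow_le_pow_left₀ (abs_nonneg _) hin 2
    rw [e, ← norm_add_smul_sq]; nlinarith [hsq]
  -- powers of `u` against powers of `r₀`
  have hr8 : 0 < r₀ ^ 8 := by positivity
  have hu4 : u ^ 4 ≤ 1 / r₀ ^ 8 := by
    have e4 : ((r₀ ^ 2)⁻¹) ^ 4 = 1 / r₀ ^ 8 := by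
      rw [show (8:ℕ) = 2 * 4 by norm_num, pow_mul, inv_pow, one_div]
    calc u ^ 4 ≤ ((r₀ ^ 2)⁻¹) ^ 4 := pow_le_pow_left₀ hu0.le hur 4
      _ = 1 / r₀ ^ 8 := e4
  have hu5s : u ^ 5 * sqPath c d τ = u ^ 4 := by
    rw [hu, pow_succ, mul_assoc, inv_mul_cancel₀ hspos.ne', mul_one]
  -- combine
  have hd0 : 0 ≤ ‖d‖ := norm_nonneg d
  have hA : |d2ljSq (sqPath c d τ) * dsqPath c d τ * dsqPath c d τ| ≤ 22 * ‖d‖ ^ 2 / r₀ ^ 8 := by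
    rw [mul_assoc, abs_mul, abs_mul_self]
    calc |d2ljSq (sqPath c d τ)| * (dsqPath c d τ * dsqPath c d τ)
        ≤ 11 / 2 * u ^ 5 * (4 * sqPath c d τ * ‖d‖ ^ 2) := mul_le_mul h2 h3 (mul_self_nonneg _) (by positivity)
      _ = 22 * ‖d‖ ^ 2 * (u ^ 5 * sqPath c d τ) := by ring
      _ = 22 * ‖d‖ ^ 2 * u ^ 4 := by rw [hu5s]
      _ ≤ 22 * ‖d‖ ^ 2 * (1 / r₀ ^ 8) := by gcongr
      _ = 22 * ‖d‖ ^ 2 / r₀ ^ 8 := by ring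
  have hB : |dljSq (sqPath c d τ) * (2 * ‖d‖ ^ 2)| ≤ 2 * ‖d‖ ^ 2 / r₀ ^ 8 := by
    rw [abs_mul, abs_of_nonneg (by positivity : (0:ℝ) ≤ 2 * ‖d‖ ^ 2)]
    calc |dljSq (sqPath c d τ)| * (2 * ‖d‖ ^ 2) ≤ u ^ 4 * (2 * ‖d‖ ^ 2) := by gcongr
      _ ≤ 1 / r₀ ^ 8 * (2 * ‖d‖ ^ 2) := by gcongr
      _ = 2 * ‖d‖ ^ 2 / r₀ ^ 8 := by ring
  unfold d2bondPath
  calc |d2ljSq (sqPath c d τ) * dsqPath c d τ * dsqPath c d τ + dljSq (sqPath c d τ) * (2 * ‖d‖ ^ 2)|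
      ≤ |d2ljSq (sqPath c d τ) * dsqPath c d τ * dsqPath c d τ| + |dljSq (sqPath c d τ) * (2 * ‖d‖ ^ 2)| := abs_add_le _ _
    _ ≤ 22 * ‖d‖ ^ 2 / r₀ ^ 8 + 2 * ‖d‖ ^ 2 / r₀ ^ 8 := add_le_add hA hB
    _ = 24 * ‖d‖ ^ 2 / r₀ ^ 8 := by ring

/-- ★ **THE ONE-BOND SECOND-DIFFERENCE ESTIMATE (PROVED).**  Along an affine bond path `τ ↦ c + τ•d` that stays `≥ r₀ ≥ 1` long on `[0,1]`, the
Lennard-Jones bond energy has `|V(‖c + t d‖) − 2V(‖c + (t/2) d‖) + V(‖c‖)| ≤ 12·t²·‖d‖²/r₀⁸` for `t ∈ (0, 1]` (three mean-value steps; no hypothesis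
on `‖c‖`, `‖d‖` themselves). -/
theorem abs_secondDiff_lennardJones_bond_le (c d : E3) {r₀ t : ℝ} (hr : 1 ≤ r₀)
    (hseg : ∀ τ : ℝ, 0 ≤ τ → τ ≤ 1 → r₀ ≤ ‖c + τ • d‖) (ht : 0 < t) (ht1 : t ≤ 1) :
    |secondDiff (fun τ => lennardJones ‖c + τ • d‖) t| ≤ 12 * t ^ 2 * ‖d‖ ^ 2 / r₀ ^ 8 := by
  have hr0 : 0 < r₀ := by linarith
  -- positivity of the squared length on `[0,1]`
  have hsq : ∀ τ : ℝ, 0 ≤ τ → τ ≤ 1 → sqPath c d τ ≠ 0 := by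
    intro τ h0 h1
    have : r₀ ^ 2 ≤ sqPath c d τ := by rw [← norm_add_smul_sq]; exact pow_le_pow_left₀ hr0.le (hseg τ h0 h1) 2
    have : (0:ℝ) < sqPath c d τ := lt_of_lt_of_le (by positivity) this
    exact this.ne'
  have hD1 : ∀ τ : ℝ, 0 ≤ τ → τ ≤ 1 → HasDerivAt (bondPath c d) (dbondPath c d τ) τ :=
    fun τ h0 h1 => hasDerivAt_bondPath c d (hsq τ h0 h1)
  have hD2 : ∀ τ : ℝ, 0 ≤ τ → τ ≤ 1 → HasDerivAt (dbondPath c d) (d2bondPath c d τ) τ :=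
    fun τ h0 h1 => hasDerivAt_dbondPath c d (hsq τ h0 h1)
  have hC1 : ∀ a b : ℝ, 0 ≤ a → b ≤ 1 → ContinuousOn (bondPath c d) (Icc a b) :=
    fun a b ha hb x hx => (hD1 x (le_trans ha hx.1) (le_trans hx.2 hb)).continuousAt.continuousWithinAt
  have hC2 : ∀ a b : ℝ, 0 ≤ a → b ≤ 1 → ContinuousOn (dbondPath c d) (Icc a b) :=
    fun a b ha hb x hx => (hD2 x (le_trans ha hx.1) (le_trans hx.2 hb)).continuousAt.continuousWithinAt
  -- rewrite the second difference through `bondPath`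
  have hrw : secondDiff (fun τ => lennardJones ‖c + τ • d‖) t = bondPath c d t - 2 * bondPath c d (t / 2) + bondPath c d 0 := by
    simp only [secondDiff, lennardJones_norm_add_smul]
  rw [hrw]
  -- three mean-value steps
  obtain ⟨ξ₁, hξ₁, e₁⟩ := exists_hasDerivAt_eq_slope (bondPath c d) (dbondPath c d) (by linarith : t / 2 < t)
    (hC1 _ _ (by linarith) ht1) (fun x hx => hD1 x (by linarith [hx.1]) (by linarith [hx.2]))
  obtain ⟨ξ₂, hξ₂, e₂⟩ := exists_hasDerivAt_eq_slope (bondPath c d) (dbondPath c d) (by linarith : (0:ℝ) < t / 2)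
    (hC1 _ _ le_rfl (by linarith)) (fun x hx => hD1 x (by linarith [hx.1]) (by linarith [hx.2]))
  have hξ : ξ₂ < ξ₁ := lt_trans hξ₂.2 hξ₁.1
  obtain ⟨ζ, hζ, e₃⟩ := exists_hasDerivAt_eq_slope (dbondPath c d) (d2bondPath c d) hξ
    (hC2 _ _ hξ₂.1.le (by linarith [hξ₁.2])) (fun x hx => hD2 x (by linarith [hx.1, hξ₂.1]) (by linarith [hx.2, hξ₁.2]))
  have hne1 : t - t / 2 ≠ 0 := by linarith
  have hne2 : t / 2 - 0 ≠ 0 := by linarith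
  have hne3 : ξ₁ - ξ₂ ≠ 0 := by linarith
  have hne2' : t / 2 ≠ 0 := by linarith
  have q1 : bondPath c d t - bondPath c d (t / 2) = dbondPath c d ξ₁ * (t / 2) := by
    rw [e₁, show t - t / 2 = t / 2 by ring, div_mul_cancel₀ _ hne2']
  have q2 : bondPath c d (t / 2) - bondPath c d 0 = dbondPath c d ξ₂ * (t / 2) := by
    rw [e₂, sub_zero, div_mul_cancel₀ _ hne2']
  have q3 : dbondPath c d ξ₁ - dbondPath c d ξ₂ = d2bondPath c d ζ * (ξ₁ - ξ₂) := by
    rw [e₃, div_mul_cancel₀ _ hne3]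
  have hid : bondPath c d t - 2 * bondPath c d (t / 2) + bondPath c d 0 = t / 2 * (ξ₁ - ξ₂) * d2bondPath c d ζ := by
    have : bondPath c d t - 2 * bondPath c d (t / 2) + bondPath c d 0
        = (bondPath c d t - bondPath c d (t / 2)) - (bondPath c d (t / 2) - bondPath c d 0) := by ring
    rw [this, q1, q2, ← sub_mul, q3]; ring
  rw [hid, abs_mul, abs_mul, abs_of_pos (by linarith : (0:ℝ) < t / 2), abs_of_pos (by linarith : (0:ℝ) < ξ₁ - ξ₂)]
  have hb := abs_d2bondPath_le c d hr (hseg ζ (by linarith [hζ.1, hξ₂.1]) (by linarith [hζ.2, hξ₁.2]))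
  have hd1 : ξ₁ - ξ₂ ≤ t := by linarith [hξ₁.2, hξ₂.1]
  have hnn : 0 ≤ 24 * ‖d‖ ^ 2 / r₀ ^ 8 := by positivity
  calc t / 2 * (ξ₁ - ξ₂) * |d2bondPath c d ζ| ≤ t / 2 * t * (24 * ‖d‖ ^ 2 / r₀ ^ 8) := by
        gcongr
    _ = 12 * t ^ 2 * ‖d‖ ^ 2 / r₀ ^ 8 := by ring


/-! ### Near / far split of the clamped energy and the FAR-FIELD second-difference bound (PROVED) -/

/-- ★ the NEAR part of the clamped energy about the centre `x₀` at range `R`: the family's own interaction energy plus its pair sums against the frozen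
field INSIDE `B̄(x₀, R)` — a FINITE-range functional of the family once `X ∩ B̄(x₀, R)` is finite. -/
def nearClampedEnergy (X : Set E3) (x₀ : E3) (R : ℝ) {n : ℕ} (xf : Fin n → E3) : ℝ :=
  interactionEnergy lennardJones xf + ∑ i, ∑' y : ↥(X ∩ closedBall x₀ R), lennardJones (dist (xf i) (y : E3))

/-- ★ the FAR part: the family's pair sums against the frozen field OUTSIDE `B̄(x₀, R)`. -/
def farClampedEnergy (X : Set E3) (x₀ : E3) (R : ℝ) {n : ℕ} (xf : Fin n → E3) : ℝ :=
  ∑ i, ∑' y : ↥(X \ closedBall x₀ R), lennardJones (dist (xf i) (y : E3))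

/-- `summable_coe_subset` (docstring added by the landing lane; see the module docstring). [formal bookkeeping] -/
theorem summable_coe_subset {S A : Set E3} (hAS : A ⊆ S) {f : E3 → ℝ} (h : Summable fun p : S => f p) :
    Summable fun p : A => f p := by
  have := h.comp_injective (Set.inclusion_injective hAS)
  simpa [Function.comp_def] using this

/-- `tsum_coe_eq_inter_add_diff` (docstring added by the landing lane; see the module docstring). [formal bookkeeping] -/
theorem tsum_coe_eq_inter_add_diff (X B : Set E3) (f : E3 → ℝ) (h : Summable fun p : X => f p) :
    ∑' p : X, f p = ∑' p : ↥(X ∩ B), f p + ∑' p : ↥(X \ B), f p := by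
  have h1 : Summable (f ∘ ((↑) : ↥(X ∩ B) → E3)) := summable_coe_subset (fun p hp => hp.1) h
  have h2 : Summable (f ∘ ((↑) : ↥(X \ B) → E3)) := summable_coe_subset (fun p hp => hp.1) h
  have hd : Disjoint (X ∩ B) (X \ B) := Set.disjoint_left.2 fun p hp hq => hq.2 hp.2
  rw [← h1.tsum_union_disjoint hd h2]
  exact tsum_congr_set_coe f (Set.inter_union_sdiff X B).symm

/-- ★ **NEAR + FAR = CLAMPED (PROVED)**: for a family whose pair sums against `X` are summable, `clampedEnergy X = nearClampedEnergy X x₀ R + farClampedEnergy X x₀ R`. -/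
theorem clampedEnergy_eq_near_add_far (X : Set E3) (x₀ : E3) (R : ℝ) {n : ℕ} (xf : Fin n → E3)
    (hsum : ∀ i, Summable fun y : X => lennardJones (dist (xf i) (y : E3))) :
    clampedEnergy X xf = nearClampedEnergy X x₀ R xf + farClampedEnergy X x₀ R xf := by
  have h : ∀ i, ∑' y : X, lennardJones (dist (xf i) (y : E3))
      = ∑' y : ↥(X ∩ closedBall x₀ R), lennardJones (dist (xf i) (y : E3)) + ∑' y : ↥(X \ closedBall x₀ R), lennardJones (dist (xf i) (y : E3)) :=
    fun i => tsum_coe_eq_inter_add_diff X (closedBall x₀ R) (fun p => lennardJones (dist (xf i) p)) (hsum i)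
  unfold clampedEnergy nearClampedEnergy farClampedEnergy
  rw [add_assoc, ← Finset.sum_add_distrib, Finset.sum_congr rfl fun i _ => h i]

/-- `secondDiff_finset_sum` (docstring added by the landing lane; see the module docstring). [formal bookkeeping] -/
theorem secondDiff_finset_sum {ι : Type*} (s : Finset ι) (g : ι → ℝ → ℝ) (t : ℝ) :
    secondDiff (fun τ => ∑ i ∈ s, g i τ) t = ∑ i ∈ s, secondDiff (g i) t := by
  simp only [secondDiff, Finset.sum_add_distrib, Finset.sum_sub_distrib, Finset.mul_sum]

/-- `secondDiff_tsum` (docstring added by the landing lane; see the module docstring). [formal bookkeeping] -/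
theorem secondDiff_tsum {ι : Type*} (g : ι → ℝ → ℝ) (t : ℝ) (h1 : Summable fun i => g i t)
    (h2 : Summable fun i => g i (t / 2)) (h0 : Summable fun i => g i 0) :
    secondDiff (fun τ => ∑' i, g i τ) t = ∑' i, secondDiff (g i) t := by
  unfold secondDiff
  rw [← tsum_mul_left, ← (h1.tsum_sub (h2.mul_left 2)), ← ((h1.sub (h2.mul_left 2)).tsum_add h0)]

/-- `abs_tsum_le_tsum_of_abs_le'` (docstring added by the landing lane; see the module docstring). [formal bookkeeping] (dedup gate: an identical public twin is already landed elsewhere in the tree; kept PRIVATE here to keep the import closure local) -/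
private theorem abs_tsum_le_tsum_of_abs_le' {ι : Type*} {f g : ι → ℝ} (hg : Summable g) (h : ∀ i, |f i| ≤ g i) :
    |∑' i, f i| ≤ ∑' i, g i := by
  have hfa : Summable fun i => |f i| := Summable.of_nonneg_of_le (fun i => abs_nonneg _) h hg
  have hfn : Summable fun i => ‖f i‖ := by simpa [Real.norm_eq_abs] using hfa
  calc |∑' i, f i| = ‖∑' i, f i‖ := (Real.norm_eq_abs _).symm
    _ ≤ ∑' i, ‖f i‖ := norm_tsum_le_tsum_norm hfn
    _ = ∑' i, |f i| := by simp [Real.norm_eq_abs]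
    _ ≤ ∑' i, g i := hfa.tsum_le_tsum h hg

/-- a point of the segment between two points of `B̄(x₀, Rc)` lies in `B̄(x₀, Rc)`. -/
theorem dist_segConf_le {n : ℕ} {y xf : Fin n → E3} {x₀ : E3} {Rc : ℝ} (hy : ∀ i, dist (y i) x₀ ≤ Rc)
    (hxf : ∀ i, dist (xf i) x₀ ≤ Rc) {τ : ℝ} (h0 : 0 ≤ τ) (h1 : τ ≤ 1) (i : Fin n) : dist (segConf y xf τ i) x₀ ≤ Rc := by
  have hdec : segConf y xf τ i - x₀ = (1 - τ) • (y i - x₀) + τ • (xf i - x₀) := by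
    simp only [segConf, smul_sub, sub_smul, one_smul]; abel
  rw [dist_eq_norm, hdec]
  have hy' := hy i
  have hxf' := hxf i
  rw [dist_eq_norm] at hy' hxf'
  calc ‖(1 - τ) • (y i - x₀) + τ • (xf i - x₀)‖ ≤ ‖(1 - τ) • (y i - x₀)‖ + ‖τ • (xf i - x₀)‖ := norm_add_le _ _
    _ = (1 - τ) * ‖y i - x₀‖ + τ * ‖xf i - x₀‖ := by
        rw [norm_smul, norm_smul, Real.norm_eq_abs, Real.norm_eq_abs, abs_of_nonneg (by linarith), abs_of_nonneg h0]
    _ ≤ (1 - τ) * Rc + τ * Rc := by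
        have h1' : 0 ≤ 1 - τ := by linarith
        nlinarith
    _ = Rc := by ring

/-- ★ **THE FAR-FIELD SECOND-DIFFERENCE BOUND (PROVED).**  If the frozen field `X ⊆ S` has summable Lennard-Jones pair sums, the family's endpoints lie
in `B̄(x₀, Rc)`, `R ≥ Rc + 1`, and the far shell's inverse-eighth moment `Σ'_{p ∈ X ∖ B̄(x₀,R)} (dist p x₀ − Rc)⁻⁸` is `≤ T`: the far part's second differences
along the matched segment are `≤ 12·T·t²·Σᵢ dist(xf i, y i)²` in absolute value. -/
theorem abs_secondDiff_farClampedEnergy_le {S X : Set E3} (hXS : X ⊆ S) (x₀ : E3) {R Rc T : ℝ}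
    (hR1 : Rc + 1 ≤ R)
    (hsum : ∀ z : E3, Summable fun p : S => lennardJones (dist z (p : E3)))
    (hTs : Summable fun p : ↥(X \ closedBall x₀ R) => ((dist (p : E3) x₀ - Rc) ^ 8)⁻¹)
    (hT : ∑' p : ↥(X \ closedBall x₀ R), ((dist (p : E3) x₀ - Rc) ^ 8)⁻¹ ≤ T)
    {n : ℕ} {y xf : Fin n → E3} (hy : ∀ i, dist (y i) x₀ ≤ Rc) (hxf : ∀ i, dist (xf i) x₀ ≤ Rc)
    {t : ℝ} (ht : 0 < t) (ht1 : t ≤ 1) :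
    |secondDiff (fun τ => farClampedEnergy X x₀ R (segConf y xf τ)) t| ≤ 12 * T * t ^ 2 * ∑ i, dist (xf i) (y i) ^ 2 := by
  set A : Set E3 := X \ closedBall x₀ R with hA
  have hAS : A ⊆ S := fun p hp => hXS hp.1
  -- per-bond estimate
  have key : ∀ (i : Fin n) (p : A),
      |secondDiff (fun τ => lennardJones (dist (segConf y xf τ i) (p : E3))) t|
        ≤ 12 * t ^ 2 * dist (xf i) (y i) ^ 2 * ((dist (p : E3) x₀ - Rc) ^ 8)⁻¹ := by
    intro i p
    have hpR : R < dist (p : E3) x₀ := by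
      have := p.2.2; rwa [mem_closedBall, not_le] at this
    set r₀ : ℝ := dist (p : E3) x₀ - Rc with hr₀
    have hr1 : 1 ≤ r₀ := by rw [hr₀]; linarith
    have hpt : ∀ τ : ℝ, dist (segConf y xf τ i) (p : E3) = ‖(y i - p) + τ • (xf i - y i)‖ := by
      intro τ; rw [dist_eq_norm]; congr 1; simp only [segConf]; abel
    have hfun : (fun τ => lennardJones (dist (segConf y xf τ i) (p : E3))) = fun τ => lennardJones ‖(y i - p) + τ • (xf i - y i)‖ := by
      funext τ; rw [hpt]
    have hseg : ∀ τ : ℝ, 0 ≤ τ → τ ≤ 1 → r₀ ≤ ‖(y i - p) + τ • (xf i - y i)‖ := by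
      intro τ h0 h1
      have hball := dist_segConf_le hy hxf h0 h1 i
      have htri := dist_triangle (p : E3) (segConf y xf τ i) x₀
      rw [← hpt, dist_comm, hr₀]; linarith
    rw [hfun]
    have := abs_secondDiff_lennardJones_bond_le (y i - p) (xf i - y i) hr1 hseg ht ht1
    rw [← dist_eq_norm, div_eq_mul_inv] at this
    exact this
  -- summability of the bond families over the far shell
  have hS : ∀ (τ : ℝ) (i : Fin n), Summable fun p : A => lennardJones (dist (segConf y xf τ i) (p : E3)) :=
    fun τ i => summable_coe_subset hAS (f := fun q => lennardJones (dist (segConf y xf τ i) q)) (hsum _)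
  -- push the second difference through the sums
  have hlin : secondDiff (fun τ => farClampedEnergy X x₀ R (segConf y xf τ)) t
      = ∑ i, ∑' p : A, secondDiff (fun τ => lennardJones (dist (segConf y xf τ i) (p : E3))) t := by
    unfold farClampedEnergy
    rw [secondDiff_finset_sum]
    refine Finset.sum_congr rfl fun i _ => ?_
    exact secondDiff_tsum (fun (p : A) τ => lennardJones (dist (segConf y xf τ i) (p : E3))) t (hS _ i) (hS _ i) (hS _ i)
  rw [hlin]
  have hw : ∀ i : Fin n, Summable fun p : A => 12 * t ^ 2 * dist (xf i) (y i) ^ 2 * ((dist (p : E3) x₀ - Rc) ^ 8)⁻¹ :=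
    fun i => hTs.mul_left _
  have hTn : ∀ i : Fin n, (0:ℝ) ≤ 12 * t ^ 2 * dist (xf i) (y i) ^ 2 := fun i => by positivity
  calc |∑ i, ∑' p : A, secondDiff (fun τ => lennardJones (dist (segConf y xf τ i) (p : E3))) t|
      ≤ ∑ i, |∑' p : A, secondDiff (fun τ => lennardJones (dist (segConf y xf τ i) (p : E3))) t| := Finset.abs_sum_le_sum_abs _ _
    _ ≤ ∑ i, ∑' p : A, 12 * t ^ 2 * dist (xf i) (y i) ^ 2 * ((dist (p : E3) x₀ - Rc) ^ 8)⁻¹ :=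
        Finset.sum_le_sum fun i _ => abs_tsum_le_tsum_of_abs_le' (hw i) (key i)
    _ = ∑ i, 12 * t ^ 2 * dist (xf i) (y i) ^ 2 * ∑' p : A, ((dist (p : E3) x₀ - Rc) ^ 8)⁻¹ :=
        Finset.sum_congr rfl fun i _ => tsum_mul_left
    _ ≤ ∑ i, 12 * t ^ 2 * dist (xf i) (y i) ^ 2 * T :=
        Finset.sum_le_sum fun i _ => mul_le_mul_of_nonneg_left hT (hTn i)
    _ = 12 * T * t ^ 2 * ∑ i, dist (xf i) (y i) ^ 2 := by rw [Finset.mul_sum]; exact Finset.sum_congr rfl fun i _ => by ring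

end Summit.AtomisticToContinuum.Crystallization.Theorems.ChartedZeroExcessLayeredLatticeLiouville

end
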